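import Summits.BirchSwinnertonDyer.BirchSwinnertonDyer.Theorems.SignedLowerHalvesSmallImageLowerHalfBothSignsMuRiderTwoLayersThree
import HarnessLib

/-!
# Route `SignedLowerHalves`, child crux L `SmallImageLowerHalfBothSigns` (item stmt-BirchSwinnertonDyer-23599), line
# `birth_acns` v14, stub `stub_muBothSigns_ns`: the `p = 3` both-signs CERTIFICATE from ANY two layers of opposite parity
# (cell `bsd-ssimc`, width seat `bsd-line-slh-p3-w2` gen 2; helper `--supports 23599`; THEOREMS ONLY; part 3, companion of
# `…MuRiderTwoLayersThree.lean`)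

HONEST FRAMING.  Child L, crux 4 and BSD are OPEN and NOT proved by anything here; no definition, no named fact, no `sorry`.
Part 2 (`…MuRiderTwoLayersThree`, the `a₃ = 0` twin of x8's `collapseLS`) reads two CONSECUTIVE layers `m, m+1`, as the x8
carrier `CycWindingUnitTwoLayersAt` is phrased.  The collapse itself only needs ONE odd and ONE even Mazur–Tate index
(`forall_chromaticL_muZero_of_mazurTate_odd_even`), so ANY two layers `m₁, m₂ ≥ 1` with `m₁ + m₂` odd suffice: this file records
that flexibility for the census road (an engine may certify any even-exponent and any odd-exponent unit layer of a pair).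
* `forall_chromaticL_muZero_of_twoParityLayers_of_frobeniusTrace_eq_zero` — `p = 3` good, `a₃ = 0`, `f` any newform, any
  Sprung pair, unit differences `[b₁/3^{m₁}]⁺_f − [0]⁺_f`, `[b₂/3^{m₂}]⁺_f − [0]⁺_f`, `m₁ + m₂` odd ⟹ every colour `≠ 0`, `μ = 0`,
  unit content, `μ(Λ/(L^•)) = 0`;
* `forall_sign_exists_signed_hasUnitContent_of_twoParityLayers_three` — the same ⟹ `∀ ε, ∃ L₀, IsSignedPAdicLFunction f 3 ε L₀ ∧
  HasUnitContent L₀` (the stub's conclusion at that pair).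

References: [Pollack2003] Def. 6.15, Prop. 6.9–6.10, Prop. 6.18; [Sprung2017] §3.1, Cor. 4.10; [Kurihara2002] Thm. 0.1;
[Kobayashi2003] Thm. 3.2, (3.4)–(3.6); [MazurTateTeitelbaum1986Invent] §I.4 (4.2), §I.10 (10.1); tree: x8's
`PrintX8LayeredStevensCollapse` / `PrintX8MazurTateThreeCollapse` / `PrintX8MazurTateMuRider`, parts 1–2 of this seat.
-/

-- D-0017: single-problem summit, the namespace repeats the problem name by design.
set_option linter.dupNamespace false
set_option autoImplicit false

noncomputable section

open scoped Classical MatrixGroups ModularForm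

open CongruenceSubgroup Polynomial WeierstrassCurve Literature.NumberTheory.EllipticCurves
  Literature.NumberTheory.EllipticCurves.ModularForms
  Literature.NumberTheory.EllipticCurves.Sprung2017
  Literature.NumberTheory.EllipticCurves.Kobayashi2003
  Literature.NumberTheory.EllipticCurves.GreenbergVatsal2000
  Literature.NumberTheory.EllipticCurves.Rank1Residual
  Summit.BirchSwinnertonDyer.Rank1Residual.X1.MuLambda
  Summit.BirchSwinnertonDyer.Rank1Residual.Supersingular
  Summit.BirchSwinnertonDyer.BirchSwinnertonDyer.Theorems.PrintX8MazurTateMuRider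
  Summit.BirchSwinnertonDyer.BirchSwinnertonDyer.Theorems.PrintX8MazurTateThreeCollapse
  Summit.BirchSwinnertonDyer.BirchSwinnertonDyer.Theorems.PrintX8LayeredStevensCollapse

namespace Summit.BirchSwinnertonDyer.BirchSwinnertonDyer.Theorems.SmallImageLowerHalfBothSignsMuRiderTwoParityLayersThree

/-! ## Two layers of OPPOSITE PARITY, not necessarily consecutive, suffice -/

section TwoParityLayers

variable {W : WeierstrassCurve ℚ} [W.IsElliptic] [W.IsGloballyMinimal] {N : ℕ} [NeZero N]
  {f : CuspForm (Gamma0 N) 2} {p : ℕ} [hp : Fact p.Prime]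

/-- **Two layers of opposite parity suffice** (`p = 3` good, `a₃ = 0`, `f` any newform of `W`, any Sprung pair): unit
winding-symbol differences `[b₁/3^{m₁}]⁺_f − [0]⁺_f` and `[b₂/3^{m₂}]⁺_f − [0]⁺_f` at layers `m₁, m₂ ≥ 1` with `m₁ + m₂` ODD
(any distance apart) give every colour `≠ 0`, `μ = 0`, unit content — the collapse reads `θ_{m−1}` at each layer and
`forall_chromaticL_muZero_of_mazurTate_odd_even` only needs one odd and one even index.  (For a census engine: ANY
even-exponent unit layer plus ANY odd-exponent unit layer is a both-signs certificate.)
[cite: Pollack2003, Def. 6.15, Prop. 6.9 and Prop. 6.10] [cite: Sprung2017, §3.1 and Cor. 4.10] [cite: Kurihara2002, Thm. 0.1] -/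
theorem forall_chromaticL_muZero_of_twoParityLayers_of_frobeniusTrace_eq_zero (hp3 : p = 3)
    (hgood : W.HasGoodReductionAtPrime p) (hap0 : W.frobeniusTrace p = 0) (hf : IsNewformOf W f)
    {Lsharp Lflat : IwasawaAlgebra p} (hSP : IsSprungPair f p (W.frobeniusTrace p) Lsharp Lflat)
    {m₁ m₂ : ℕ} (hm₁ : 1 ≤ m₁) (hm₂ : 1 ≤ m₂) (hpar : Odd (m₁ + m₂)) {b₁ b₂ : ℤ}
    (hb₁ : ¬ (p : ℤ) ∣ b₁) (hb₂ : ¬ (p : ℤ) ∣ b₂)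
    (h1 : 1 ≤ ‖((ratPlusSymbol f ((b₁ : ℚ) / (p : ℚ) ^ m₁) - ratPlusSymbol f 0 : ℚ) : ℚ_[p])‖)
    (h2 : 1 ≤ ‖((ratPlusSymbol f ((b₂ : ℚ) / (p : ℚ) ^ m₂) - ratPlusSymbol f 0 : ℚ) : ℚ_[p])‖)
    (c : Chroma) :
    chromaticL c Lsharp Lflat ≠ 0 ∧ mu (chromaticL c Lsharp Lflat) = 0 ∧
      HasUnitContent (chromaticL c Lsharp Lflat) ∧
      muInvariant p (IwasawaAlgebra p ⧸ Ideal.span {chromaticL c Lsharp Lflat}) = 0 := by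
  suffices hred : red (chromaticL c Lsharp Lflat) ≠ 0 from
    ⟨ne_zero_of_red_ne_zero hred, (mu_eq_zero_and_lam_eq_of_red_ne_zero hred).1,
      hasUnitContent_of_red_ne_zero hred, muInvariant_quotient_span_eq_zero_of_red_ne_zero hred⟩
  subst hp3
  have hp2 : (3 : ℕ) ≠ 2 := by decide
  have hap3 : ((3 : ℕ) : ℤ) ∣ W.frobeniusTrace 3 := by rw [hap0]; exact dvd_zero _
  have hf0 : IsNewform0 f := hf.1
  have hpN : ¬ 3 ∣ N := not_dvd_level_of_isNewformOf hf hgood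
  have hap : cuspCoeff f 3 = ((W.frobeniusTrace 3 : ℤ) : ℂ) :=
    cuspCoeff_eq_frobeniusTrace_of_isNewformOf_holds hf hgood
  have hpa : ¬ ((3 : ℕ) : ℤ) ∣ W.frobeniusTrace 3 - 1 := by
    rw [hap0]
    norm_num
  have he : cyclotomicExponent 3 = 1 := if_neg hp2
  by_cases h0 : ‖((ratPlusSymbol f 0 : ℚ) : ℚ_[3])‖ = 1
  · -- the unit case: both colours are units of `Λ`
    have hr : ratPlusSymbol f 0 ≠ 0 := by
      intro hz
      rw [hz, Rat.cast_zero, norm_zero] at h0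
      exact zero_ne_one h0
    have hv : padicValRat 3 (ratPlusSymbol f 0) = 0 := by
      rw [Padic.eq_padicNorm, padicNorm.eq_zpow_of_nonzero hr] at h0
      have h0' : ((3 : ℚ) ^ (-padicValRat 3 (ratPlusSymbol f 0)) : ℚ) = 1 := by exact_mod_cast h0
      have h3 := (zpow_eq_one_iff_right₀ (by norm_num : (0 : ℚ) ≤ 3) (by norm_num : (3 : ℚ) ≠ 1)).mp h0'
      omega
    exact ((isUnit_chromaticL_of_frobeniusTrace_eq_zero hp2 hf hgood hap0 hSP c hr hv).map
      (PowerSeries.map (IsLocalRing.residue ℤ_[3]))).ne_zero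
  · have h0lt : ‖((ratPlusSymbol f 0 : ℚ) : ℚ_[3])‖ < 1 := by
      refine lt_of_le_of_ne ?_ h0
      have h := norm_ratPlusSymbol_div_pow_le_one_of_not_dvd hp2 hf0 hpN hap hpa 0 0
      simpa using h
    -- one unit layer `m = n + 1` ⟹ an integral model of `θ_n` with `red ≠ 0`
    have hlayer : ∀ (n : ℕ) {b : ℤ}, ¬ ((3 : ℕ) : ℤ) ∣ b →
        1 ≤ ‖((ratPlusSymbol f ((b : ℚ) / ((3 : ℕ) : ℚ) ^ (n + 1)) - ratPlusSymbol f 0 : ℚ) : ℚ_[3])‖ →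
        ∃ Θ : IwasawaAlgebra 3, iwasawaToPowerSeries 3 Θ =
          ((mazurTateElement f 3 n).map (algebraMap ℚ ℚ_[3]) : PowerSeries ℚ_[3]) ∧ Θ ≠ 0 ∧ mu Θ = 0 := by
      intro n b hb h
      have hu : ‖((ratPlusSymbol f ((((b : ZMod (3 ^ (n + 1))).val : ℕ) : ℚ) /
          ((3 : ℕ) : ℚ) ^ (n + 1)) : ℚ) : ℚ_[3])‖ = 1 := by
        rw [← ratPlusSymbol_intCast_div_pow_eq_val f 3 (n + 1) b]
        rw [Rat.cast_sub] at h
        exact norm_eq_one_of_one_le_norm_sub 3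
          (by rw [ratPlusSymbol_intCast_div_pow_eq_val f 3 (n + 1) b]
              exact norm_ratPlusSymbol_div_pow_le_one_of_not_dvd hp2 hf0 hpN hap hpa _ _) h0lt h
      obtain ⟨P, hP⟩ := exists_map_eq_map_mazurTateElement_of_not_dvd hp2 hf0 hpN hap hpa n
      have hΘ : iwasawaToPowerSeries 3 (P : PowerSeries ℤ_[3]) =
          ((mazurTateElement f 3 n).map (algebraMap ℚ ℚ_[3]) : PowerSeries ℚ_[3]) := by
        rw [← hP, Polynomial.polynomial_map_coe]
      have hred : red (P : PowerSeries ℤ_[3]) ≠ 0 :=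
        red_ne_zero_of_mazurTate_of_norm_ratPlusSymbol_eq_one f rfl hf0 hpN hap hpa hΘ
          (not_dvd_val_intCast 3 (L := n + 1) (by omega) hb) (by rw [he]; exact hu)
      exact ⟨(P : PowerSeries ℤ_[3]), hΘ, ne_zero_of_red_ne_zero hred,
        (mu_eq_zero_and_lam_eq_of_red_ne_zero hred).1⟩
    obtain ⟨n₁, rfl⟩ : ∃ n, m₁ = n + 1 := ⟨m₁ - 1, by omega⟩
    obtain ⟨n₂, rfl⟩ : ∃ n, m₂ = n + 1 := ⟨m₂ - 1, by omega⟩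
    obtain ⟨Θ₁, hΘ₁, hΘ₁0, hμ₁⟩ := hlayer n₁ hb₁ h1
    obtain ⟨Θ₂, hΘ₂, hΘ₂0, hμ₂⟩ := hlayer n₂ hb₂ h2
    -- `n₁ + n₂` is odd, so one index is odd and the other even
    have key : ∀ c' : Chroma, chromaticL c' Lsharp Lflat ≠ 0 ∧ mu (chromaticL c' Lsharp Lflat) = 0 ∧
        HasUnitContent (chromaticL c' Lsharp Lflat) ∧
        muInvariant 3 (IwasawaAlgebra 3 ⧸ Ideal.span {chromaticL c' Lsharp Lflat}) = 0 := by
      intro c'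
      rcases Nat.even_or_odd n₁ with hn₁ | hn₁
      · have hn₂ : Odd n₂ := by
          rcases Nat.even_or_odd n₂ with hn₂ | hn₂
          · exfalso
            obtain ⟨a, ha⟩ := hn₁
            obtain ⟨b, hb⟩ := hn₂
            obtain ⟨k, hk⟩ := hpar
            omega
          · exact hn₂
        exact forall_chromaticL_muZero_of_mazurTate_odd_even hp2 hf hgood hap3 hSP hn₂ hn₁ hΘ₂ hΘ₂0 hμ₂
          hΘ₁ hΘ₁0 hμ₁ c'
      · have hn₂ : Even n₂ := by
          rcases Nat.even_or_odd n₂ with hn₂ | hn₂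
          · exact hn₂
          · exfalso
            obtain ⟨a, ha⟩ := hn₁
            obtain ⟨b, hb⟩ := hn₂
            obtain ⟨k, hk⟩ := hpar
            omega
        exact forall_chromaticL_muZero_of_mazurTate_odd_even hp2 hf hgood hap3 hSP hn₁ hn₂ hΘ₁ hΘ₁0 hμ₁
          hΘ₂ hΘ₂0 hμ₂ c'
    obtain ⟨hne, hmu, -, -⟩ := key c
    exact red_ne_zero_of_mu_eq_zero hne hmu

/-- **Two opposite-parity layers ⟹ the both-signs rider at that pair in the stub's currency** (`p = 3` good, `a₃ = 0`,
`f` any newform of `W`). [cite: Pollack2003, Prop. 6.9, Prop. 6.10 and Prop. 6.18] [cite: Kobayashi2003, Thm. 3.2 and (3.4)–(3.6) (p. 7)] -/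
theorem forall_sign_exists_signed_hasUnitContent_of_twoParityLayers_three (hp3 : p = 3)
    (hgood : W.HasGoodReductionAtPrime p) (hap0 : W.frobeniusTrace p = 0) (hf : IsNewformOf W f)
    {m₁ m₂ : ℕ} (hm₁ : 1 ≤ m₁) (hm₂ : 1 ≤ m₂) (hpar : Odd (m₁ + m₂)) {b₁ b₂ : ℤ}
    (hb₁ : ¬ (p : ℤ) ∣ b₁) (hb₂ : ¬ (p : ℤ) ∣ b₂)
    (h1 : 1 ≤ ‖((ratPlusSymbol f ((b₁ : ℚ) / (p : ℚ) ^ m₁) - ratPlusSymbol f 0 : ℚ) : ℚ_[p])‖)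
    (h2 : 1 ≤ ‖((ratPlusSymbol f ((b₂ : ℚ) / (p : ℚ) ^ m₂) - ratPlusSymbol f 0 : ℚ) : ℚ_[p])‖)
    (ε : ℤˣ) : ∃ L₀ : IwasawaAlgebra p, IsSignedPAdicLFunction f p ε L₀ ∧ HasUnitContent L₀ := by
  have hp2 : p ≠ 2 := by omega
  obtain ⟨Lplus, Lminus, hPP⟩ :=
    exists_isPollackPair pollack_exists_plusMinusPAdicLFunction_holds hp2 hf hgood hap0
  have hSP : IsSprungPair f p (W.frobeniusTrace p) Lplus Lminus := by
    rw [hap0]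
    exact (isSprungPair_zero_iff f p Lplus Lminus).mpr ⟨hPP.2.2.1, hPP.2.2.2⟩
  refine ⟨kobayashiL ε Lplus Lminus, hPP.isSignedPAdicLFunction_kobayashiL ε, ?_⟩
  rcases Int.units_eq_one_or ε with rfl | rfl
  · have h := (forall_chromaticL_muZero_of_twoParityLayers_of_frobeniusTrace_eq_zero hp3 hgood hap0 hf hSP hm₁
      hm₂ hpar hb₁ hb₂ h1 h2 .flat).2.2.1
    rw [chromaticL_flat] at h
    rw [kobayashiL, if_pos rfl]
    exact h
  · have h := (forall_chromaticL_muZero_of_twoParityLayers_of_frobeniusTrace_eq_zero hp3 hgood hap0 hf hSP hm₁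
      hm₂ hpar hb₁ hb₂ h1 h2 .sharp).2.2.1
    rw [chromaticL_sharp] at h
    have hne : ((-1 : ℤˣ) = 1) ↔ False := by decide
    rw [kobayashiL, if_neg hne.mp]
    exact h

end TwoParityLayers

end Summit.BirchSwinnertonDyer.BirchSwinnertonDyer.Theorems.SmallImageLowerHalfBothSignsMuRiderTwoParityLayersThree

end
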